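import Summits.AtomisticToContinuum.Crystallization.Theorems.FrustratedLawDichotomyStrainedPatchHomForceKit
import Summits.AtomisticToContinuum.Crystallization.Theorems.FrustratedLawDichotomyStrainedPatchHomExemptMoveBox

/-!
# (C′) FORCE/EXEMPT PRUNE, kernel kit part 2: the 7-ball classification of a label, the label-list sum, and the slope THRESHOLD test
# (27623 strained-patch piece, `(H) HomFloor`, hcp half; decomp-a2c hand-2 g27 — sequel of `…HomForceKit`)

Part 1 encloses the closed-form slope of ONE lattice term along the one-atom move `τ ↦ τ•e`.  `MoveUnstableCore 0 7 s` sums over the displacements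
`v ≠ 0` with `‖v‖ ≤ 7` only, and that index set depends on `(U, ξ)` inside a box; this module adds the kernel-side CLASSIFICATION of a label against
the `7`-ball and the list sum with its real meaning:

* §1 `cutSlope v e τ` (real) = LITERALLY the slope kernel of hand-1 g26's `…HomExemptMoveBox.exemptNear_of_boxSlope`
  (`𝟙[v ≠ 0 ∧ ‖v‖ ≤ 7]·(‖τe − v‖⁻⁸ − ‖τe − v‖⁻¹⁴)·⟪τe − v, e⟫`; `closedForm_eq_kernel` identifies it with part 1's closed form); `termHi` (kernel): `0` if the label is CERTAINLY outside the ball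
  (`(dot3 V V).lo > 49·SC`) or is the skipped zero label, else `S.hi` if certainly inside, else `max S.hi 0` (straddling labels contribute their
  nonnegative part only); ★ `cutSlope_le_termHi`: `cutSlope · SC ≤ termHi` whenever the components of `v` lie in `V` (and `v = 0` in the skip case);
* §2 the label box `[−11,11]³` (`box11 = …HomExemptMoveBox`'s), `termVal`/`termOK`, ★ `boxSlopeHi` (both families, zero label skipped) with
  ★★ `boxSlope_le`: the two box sums of the slope kernel are `≤ boxSlopeHi/SC` (uses `latPt_hex_injective`, `norm_shifted_gt` for `v ≠ 0`);
* §3 the threshold arithmetic `slopeTestOK G sn sd := 0 < sn ∧ 8sn ≤ 3sd ∧ G·(7·sd − sn)⁷ < −8892·sd⁷·SC` ⟺ `0 < s ≤ 3/8`, `G/SC < −(7/(7−s))⁷·S₇♯(7)`;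
* §4 ★★★ the leaf `forceOutDir en ed sn sd c w` (direction at most unit ∧ all labels enclosed ∧ threshold) and ★★★ `forceOutDir_sound`: the `hver` prune
  disjunct (`ExemptNear (9/5) ExRec`) for every `(U, ξ)` of the box, by hand-1 g26's `…HomExemptMoveBox.exemptNear_of_boxSlope` with `b := −G/SC`.
MEASURED (hand-2 g27, interpreter `#eval` of these very definitions on the FINDING-A box of critic row 1019 — `U = diag(.97053,.97184,.97352) + off
(u01 −.00225, u02 .01562, u12 .00270)`, `ξ = (.02824,.00511,.00157)` —, step `s = 10⁻⁶`): POINT slopes `boxSlopeHi/SC` = `−0.191` along `+x̂` (= `−|f|`,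
`|f| = 0.192` of row 1019 ✓), `−0.185` / `+0.185` along `±ξ̂`, `+0.010` (`ŷ`), `+0.017` (`ẑ`) against the threshold `−0.0108`; with uniform half-width
`2⁻¹³` in the twelve coordinates `−0.103` (the leaf FIRES in the interpreter: `forceOutDir ![982,177,55] 1000 1 1000000 c w = true` for that centre `c` and `w ≡ 2^35`), at `2⁻¹¹`
`+0.14`, at `2⁻⁹` `+1.11` (FAILS): the naive interval form loses `≈ 650·w` (first-shell `u⁷` dependency), so it closes only at `≲ 2⁻¹²`; at `s = 10⁻³` the
`τ`-interval alone costs `±0.18` (keep `s ≤ 10⁻⁵`).  KERNEL: `decide +kernel` on the `Fintype.piFinset` form of the 2 × 12167-label sum is NOT feasible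
(«(kernel) excessive memory consumption», 14 min) — the production Boolean must fold a LITERAL label list in the ℕ-encoded style of the (P4) leaf
(`…HomLeafTableCheck`), with `box11`/`boxSlope_le` as its specification.
What remains (g28): the CENTRED form of `boxSlopeHi` (value at the box centre + gradient classes, (P4) points-form style) for the `2⁻⁹` programme; the direction MENU verdict `forceOut c w := dirs.any …` + `entryLeafOKHX := forceOut ∨ entryLeafOKHQ μ` + `hcpHalf_of_entryTreeHX`
(10-line plumbing, template `…HomEntryQuickHcp`), the Finding-A MustPass / sheet MustFail pilot (`decide +kernel` cost of the 2 × 12167-label box sum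
to be MEASURED; if too slow, replace the `Finset` sums by a literal label list + covering proof as in the (P4) leaf).
All definitions computable; 0 sorry; axioms standard; no instances / notation.  `--supports stmt-AtomisticToContinuum-27623`.
-/

namespace Summit.AtomisticToContinuum.Crystallization.Theorems.FrustratedLawDichotomyStrainedPatchHomForceSum

open scoped BigOperators RealInnerProductSpace
open Literature.Analysis.ValidatedNumerics.Numerics
open Summit.AtomisticToContinuum.Crystallization.Theorems.ChargedEnergyGapNegative (E3)
open Summit.AtomisticToContinuum.Crystallization.Theorems.FrustratedLawDichotomyStrainedPatchHomEntryGramHcp (dot3 mem_dot3)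
open Summit.AtomisticToContinuum.Crystallization.Theorems.FrustratedLawDichotomyStrainedPatchHomForceKit
open Summit.AtomisticToContinuum.Crystallization.Theorems.FrustratedLawDichotomyStrainedPatchHomSplit
open Summit.AtomisticToContinuum.Crystallization.Theorems.FrustratedLawDichotomyAveragingRuleTightFree (TightNearCap BadNearCap)
open Summit.AtomisticToContinuum.Crystallization.Theorems.FrustratedLawDichotomyExemptAbsorption (ExemptNear)
open Summit.AtomisticToContinuum.Crystallization.Theorems.FrustratedLawDichotomyStrainedPatchHomEntryGram (entryFI mem_entryFI)
open Summit.AtomisticToContinuum.Crystallization.Theorems.FrustratedLawDichotomyStrainedPatchHomEntryGramHcp (shufFI mem_shufFI)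
open Summit.AtomisticToContinuum.Crystallization.Theorems.FrustratedLawDichotomyStrainedPatchHomLatticeBox (latPt_zero)
open Summit.AtomisticToContinuum.Crystallization.Theorems.FrustratedLawDichotomyStrainedPatchHomLatticeBoxHcp (latPt_hex_injective norm_shifted_gt)
open Summit.AtomisticToContinuum.Crystallization.Theorems.FrustratedLawDichotomyStrainedPatchHomExemptMove (exemptNear_of_boxSlope)

/-! ## §1. One label against the `7`-ball -/

/-- The CUT slope term of a displacement `v` along the move `τ•e`: the closed-form slope if `v ≠ 0` and `‖v‖ ≤ 7`, else `0`
(the summand of the derivative of the `R_m = 7` local field of `MoveUnstableCore 0 7 s`). -/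
noncomputable def cutSlope (v e : E3) (τ : ℝ) : ℝ :=
  if v ≠ 0 ∧ ‖v‖ ≤ 7 then ((‖τ • e - v‖⁻¹) ^ 8 - (‖τ • e - v‖⁻¹) ^ 14) * ⟪τ • e - v, e⟫ else 0

/-- The closed form of part 1 IS the slope kernel of `…HomExemptMoveBox.exemptNear_of_boxSlope`:
`((Q⁻¹)⁴ − (Q⁻¹)⁷)·(τ⟪e,e⟫ − ⟪v,e⟫) = (‖τe − v‖⁻⁸ − ‖τe − v‖⁻¹⁴)·⟪τe − v, e⟫`, `Q = ‖τe − v‖²`. [formal bookkeeping] -/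
theorem closedForm_eq_kernel (v e : E3) (τ : ℝ) :
    ((‖τ • e - v‖ ^ 2)⁻¹ ^ 4 - (‖τ • e - v‖ ^ 2)⁻¹ ^ 7) * (τ * ⟪e, e⟫ - ⟪v, e⟫) =
      ((‖τ • e - v‖⁻¹) ^ 8 - (‖τ • e - v‖⁻¹) ^ 14) * ⟪τ • e - v, e⟫ := by
  rw [inner_sub_left, real_inner_smul_left, ← inv_pow, ← pow_mul, ← pow_mul]

/-- Kernel upper bound (scaled) of the cut slope term of ONE label with component enclosures `V`; `skip = true` marks the zero label (centre itself).
`none` = no enclosure (the leaf must fail). -/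
def termHi (en : Fin 3 → ℤ) (ed : ℕ) (sn : ℤ) (sd : ℕ) (skip : Bool) (V : Fin 3 → FI) : Option ℤ :=
  if skip then some 0
  else if 49 * (SC : ℤ) < (dot3 V V).lo then some 0
  else match slopeFI en ed sn sd V with
    | none => none
    | some S => if (dot3 V V).hi ≤ 49 * (SC : ℤ) then some S.hi else some (max S.hi 0)

/-- ★ `cutSlope · SC ≤ termHi`: the kernel bound dominates the cut slope term.  The caller passes `skip = true` exactly for the zero label
(`v = 0`, the centre itself, not a summand) and guarantees `v ≠ 0` otherwise. [folklore] -/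
theorem cutSlope_le_termHi {en : Fin 3 → ℤ} {ed : ℕ} (hed : 0 < ed) {sn : ℤ} {sd : ℕ} (hsd : 0 < sd) {τ : ℝ} (h0 : 0 ≤ τ)
    (hs : τ ≤ (sn : ℝ) / sd) {v : E3} {V : Fin 3 → FI} (hv : ∀ a, FI.mem (v a) (V a)) {skip : Bool} (hskip : skip = true → v = 0)
    (hnz : skip = false → v ≠ 0) {t : ℤ} (h : termHi en ed sn sd skip V = some t) : cutSlope v (dirVec en ed) τ * SC ≤ (t : ℝ) := by
  have hS := SC_pos
  have hQ : FI.mem (‖v‖ ^ 2) (dot3 V V) := by rw [← real_inner_self_eq_norm_sq]; exact mem_dot3 hv hv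
  unfold termHi at h
  by_cases hsk : skip = true
  · rw [if_pos hsk] at h
    simp only [Option.some.injEq] at h
    subst h
    have hv0 : v = 0 := hskip hsk
    simp [cutSlope, hv0]
  · rw [if_neg hsk] at h
    have hne : v ≠ 0 := hnz (by simpa using hsk)
    by_cases hout : 49 * (SC : ℤ) < (dot3 V V).lo
    · rw [if_pos hout] at h
      simp only [Option.some.injEq] at h
      subst h
      -- certainly outside the ball: `‖v‖ > 7`, the cut term vanishes
      have h7 : ¬ ‖v‖ ≤ 7 := by
        intro hle
        have h1 := (FI.mem_def.1 hQ).1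
        have h2 : ((49 * (SC : ℤ) : ℤ) : ℝ) < ((dot3 V V).lo : ℝ) := by exact_mod_cast hout
        push_cast at h2
        have h3 : ‖v‖ ^ 2 ≤ 49 := by nlinarith [norm_nonneg v]
        nlinarith
      simp [cutSlope, h7]
    · rw [if_neg hout] at h
      cases hsl : slopeFI en ed sn sd V with
      | none => rw [hsl] at h; exact absurd h (by simp)
      | some S =>
        rw [hsl] at h
        dsimp only at h
        have hle : (((‖τ • dirVec en ed - v‖⁻¹) ^ 8 - (‖τ • dirVec en ed - v‖⁻¹) ^ 14) * ⟪τ • dirVec en ed - v, dirVec en ed⟫) * SC ≤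
            (S.hi : ℝ) := by
          rw [← closedForm_eq_kernel]
          exact (FI.mem_def.1 (mem_slopeFI hed hsd h0 hs hv hsl)).2
        by_cases hin : (dot3 V V).hi ≤ 49 * (SC : ℤ)
        · rw [if_pos hin] at h
          simp only [Option.some.injEq] at h
          subst h
          -- certainly inside the ball
          have h7 : ‖v‖ ≤ 7 := by
            have h1 := (FI.mem_def.1 hQ).2
            have h2 : ((dot3 V V).hi : ℝ) ≤ ((49 * (SC : ℤ) : ℤ) : ℝ) := by exact_mod_cast hin
            push_cast at h2
            have h3 : ‖v‖ ^ 2 ≤ 7 ^ 2 := by nlinarith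
            exact (abs_le_of_sq_le_sq' h3 (by norm_num)).2
          unfold cutSlope
          rw [if_pos ⟨hne, h7⟩]
          exact hle
        · rw [if_neg hin] at h
          simp only [Option.some.injEq] at h
          subst h
          unfold cutSlope
          split_ifs with hc
          · exact hle.trans (by exact_mod_cast le_max_left _ _)
          · simp only [zero_mul]; exact_mod_cast le_max_right _ _

/-! ## §2. The box sum over `[−11, 11]³`, both families -/

/-- `[−11, 11]` in the kernel (`range`/`image` form, cf. `…HomEntryFit.icc2`). -/
def icc11 : Finset ℤ := (Finset.range 23).image fun n : ℕ => (n : ℤ) - 11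

/-- `icc11 = Icc (−11) 11`. [formal bookkeeping] -/
theorem icc11_eq : icc11 = Finset.Icc (-11 : ℤ) 11 := by
  ext x
  simp only [icc11, Finset.mem_image, Finset.mem_range, Finset.mem_Icc]
  constructor
  · rintro ⟨n, hn, rfl⟩; omega
  · rintro ⟨h1, h2⟩; exact ⟨(x + 11).toNat, by omega, by omega⟩

/-- The label box `[−11, 11]³` of `…HomExemptMoveBox` in the kernel. -/
def box11 : Finset (Fin 3 → ℤ) := Fintype.piFinset fun _ : Fin 3 => icc11

/-- `box11` is the box of `exemptNear_of_boxSlope`. [formal bookkeeping] -/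
theorem box11_eq : box11 = Fintype.piFinset fun _ : Fin 3 => Finset.Icc (-11 : ℤ) 11 := by
  unfold box11; rw [icc11_eq]

/-- The per-label bound as a total integer (`0` when there is no enclosure; guarded by `termOK`). -/
def termVal (en : Fin 3 → ℤ) (ed : ℕ) (sn : ℤ) (sd : ℕ) (skip : Bool) (V : Fin 3 → FI) : ℤ :=
  match termHi en ed sn sd skip V with
  | some t => t
  | none => 0

/-- The per-label guard: an enclosure exists. -/
def termOK (en : Fin 3 → ℤ) (ed : ℕ) (sn : ℤ) (sd : ℕ) (skip : Bool) (V : Fin 3 → FI) : Bool := (termHi en ed sn sd skip V).isSome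

/-- `termVal` dominates the cut slope term when the guard holds. [folklore] -/
theorem cutSlope_le_termVal {en : Fin 3 → ℤ} {ed : ℕ} (hed : 0 < ed) {sn : ℤ} {sd : ℕ} (hsd : 0 < sd) {τ : ℝ} (h0 : 0 ≤ τ)
    (hs : τ ≤ (sn : ℝ) / sd) {v : E3} {V : Fin 3 → FI} (hv : ∀ a, FI.mem (v a) (V a)) {skip : Bool} (hskip : skip = true → v = 0)
    (hnz : skip = false → v ≠ 0) (hok : termOK en ed sn sd skip V = true) :
    cutSlope v (dirVec en ed) τ * SC ≤ (termVal en ed sn sd skip V : ℝ) := by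
  unfold termOK at hok
  unfold termVal
  cases ht : termHi en ed sn sd skip V with
  | none => rw [ht] at hok; simp at hok
  | some t => exact cutSlope_le_termHi hed hsd h0 hs hv hskip hnz ht

/-- ★ **THE BOX SLOPE BOUND** (scaled): the sum over `[−11,11]³` of the per-label bounds, `A` family (zero label skipped) plus `B` family. -/
def boxSlopeHi (en : Fin 3 → ℤ) (ed : ℕ) (sn : ℤ) (sd : ℕ) (E : Fin 3 × Fin 3 → FI) (X : Fin 3 → FI) : ℤ :=
  (∑ bb ∈ box11, termVal en ed sn sd (decide (bb = 0)) (vecA E bb)) + ∑ bb ∈ box11, termVal en ed sn sd false (vecB E X bb)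

/-- The guard of the box sum: every label of both families has an enclosure. -/
def boxOK (en : Fin 3 → ℤ) (ed : ℕ) (sn : ℤ) (sd : ℕ) (E : Fin 3 × Fin 3 → FI) (X : Fin 3 → FI) : Bool :=
  decide (∀ bb ∈ box11, termOK en ed sn sd (decide (bb = 0)) (vecA E bb) = true ∧ termOK en ed sn sd false (vecB E X bb) = true)

/-- ★★ **SOUNDNESS OF THE BOX SLOPE BOUND**: for `U` (`‖U − 1‖ ≤ 1/4`) with entries in the entry box, `ξ` (`‖ξ‖ ≤ 1/4`) in the shuffle box and every
`τ ∈ [0, s]`, the two box sums of the slope kernel of `exemptNear_of_boxSlope` at direction `e = dirVec en ed` are `≤ boxSlopeHi/SC`. [folklore] -/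
theorem boxSlope_le {c w : (Fin 3 × Fin 3) ⊕ Fin 3 → ℤ} (U : E3 →L[ℝ] E3) (ξ : E3) (hU : ‖U - 1‖ ≤ 1 / 4) (hξn : ‖ξ‖ ≤ 1 / 4)
    (hbox : ∀ ab : Fin 3 × Fin 3, |(U (EuclideanSpace.single ab.2 (1 : ℝ))) ab.1 - (c (Sum.inl ab) : ℝ) / SC| ≤ (w (Sum.inl ab) : ℝ) / SC)
    (hξ : ∀ i : Fin 3, |ξ i - (c (Sum.inr i) : ℝ) / SC| ≤ (w (Sum.inr i) : ℝ) / SC)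
    {en : Fin 3 → ℤ} {ed : ℕ} (hed : 0 < ed) {sn : ℤ} {sd : ℕ} (hsd : 0 < sd)
    (hok : boxOK en ed sn sd (entryFI (fun ab => c (Sum.inl ab)) (fun ab => w (Sum.inl ab))) (shufFI c w) = true)
    {τ : ℝ} (h0 : 0 ≤ τ) (hs : τ ≤ (sn : ℝ) / sd) :
    (∑ bb ∈ (Fintype.piFinset fun _ : Fin 3 => Finset.Icc (-11 : ℤ) 11), cutSlope (latPt U hexFrame bb) (dirVec en ed) τ +
        ∑ bb ∈ (Fintype.piFinset fun _ : Fin 3 => Finset.Icc (-11 : ℤ) 11), cutSlope (latPt U hexFrame bb + U (hcpShift + ξ)) (dirVec en ed) τ) * SC ≤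
      (boxSlopeHi en ed sn sd (entryFI (fun ab => c (Sum.inl ab)) (fun ab => w (Sum.inl ab))) (shufFI c w) : ℝ) := by
  set E := entryFI (fun ab => c (Sum.inl ab)) (fun ab => w (Sum.inl ab)) with hE
  set X := shufFI c w with hX
  have hEm : ∀ ab : Fin 3 × Fin 3, FI.mem ((U (EuclideanSpace.single ab.2 (1 : ℝ))) ab.1) (E ab) := fun ab => mem_entryFI (hbox ab)
  have hXm : ∀ i, FI.mem (ξ i) (X i) := fun i => mem_shufFI (hξ i)
  simp only [boxOK, decide_eq_true_eq] at hok
  rw [← box11_eq]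
  unfold boxSlopeHi
  push_cast
  rw [add_mul, Finset.sum_mul, Finset.sum_mul]
  refine add_le_add (Finset.sum_le_sum fun bb hbb => ?_) (Finset.sum_le_sum fun bb hbb => ?_)
  · refine cutSlope_le_termVal hed hsd h0 hs (mem_vecA U hEm bb) (fun hsk => ?_) (fun hsk => ?_) (hok bb hbb).1
    · have hb0 : bb = 0 := by simpa using hsk
      rw [hb0, latPt_zero]
    · have hb0 : bb ≠ 0 := by simpa using hsk
      intro hzero
      exact hb0 (latPt_hex_injective hU (by rw [hzero, latPt_zero]))
  · exact cutSlope_le_termVal hed hsd h0 hs (mem_vecB U ξ hEm hXm bb) (fun hsk => by simp at hsk)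
      (fun _ => (norm_pos_iff.1 ((by norm_num : (0 : ℝ) < 3 / 8).trans (norm_shifted_gt hU hξn bb)))) (hok bb hbb).2

/-! ## §3. The threshold test -/

/-- `G·(7·sd − sn)⁷ < −8892·sd⁷·SC` with `0 < sn`, `8·sn ≤ 3·sd` (`0 < s ≤ 3/8`): the scaled slope bound `G` is below `−(7/(7−s))⁷·S₇♯(7)·SC`,
`s = sn/sd`, `S₇♯(7) = 8892/7⁷` (the slack rate of `MoveUnstableCore 0 7 s`). -/
def slopeTestOK (G sn : ℤ) (sd : ℕ) : Bool :=
  decide (0 < sn) && decide (8 * sn ≤ 3 * (sd : ℤ)) && decide (G * (7 * (sd : ℤ) - sn) ^ 7 < -(8892 * (sd : ℤ) ^ 7 * (SC : ℤ)))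

/-- ★ The threshold test gives `0 < s ≤ 3/8` and `G/SC < −(7/(7 − s))⁷ · (6000/343·7⁻⁴ + 2880/49·7⁻⁵ + 10/7·7⁻⁶ + 2·7⁻⁷)`, `s = sn/sd` — the
literal slack rate of `MoveUnstableCore 0 7 s`. [folklore] -/
theorem lt_threshold_of_slopeTestOK {G sn : ℤ} {sd : ℕ} (hsd : 0 < sd) (h : slopeTestOK G sn sd = true) :
    0 < (sn : ℝ) / sd ∧ (sn : ℝ) / sd ≤ 3 / 8 ∧
      (G : ℝ) / SC < -((7 / (7 - (sn : ℝ) / sd)) ^ 7 *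
        (6000 / 343 * (7 : ℝ)⁻¹ ^ 4 + 2880 / 49 * (7 : ℝ)⁻¹ ^ 5 + 10 / 7 * (7 : ℝ)⁻¹ ^ 6 + 2 * (7 : ℝ)⁻¹ ^ 7)) := by
  simp only [slopeTestOK, Bool.and_eq_true, decide_eq_true_eq] at h
  obtain ⟨⟨hsn0, hsn7⟩, hG⟩ := h
  have hS := SC_pos
  have hsdr : (0 : ℝ) < sd := by exact_mod_cast hsd
  have hsn0r : (0 : ℝ) < sn := by exact_mod_cast hsn0
  have hsn7r : 8 * (sn : ℝ) ≤ 3 * sd := by exact_mod_cast hsn7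
  have hGr : (G : ℝ) * (7 * (sd : ℝ) - sn) ^ 7 < -(8892 * (sd : ℝ) ^ 7 * SC) := by exact_mod_cast hG
  refine ⟨div_pos hsn0r hsdr, by rw [div_le_iff₀ hsdr]; linarith, ?_⟩
  have hden : (0 : ℝ) < 7 * sd - sn := by linarith
  have e1 : (7 : ℝ) / (7 - (sn : ℝ) / sd) = 7 * sd / (7 * sd - sn) := by
    field_simp
  have e2 : (6000 / 343 * (7 : ℝ)⁻¹ ^ 4 + 2880 / 49 * (7 : ℝ)⁻¹ ^ 5 + 10 / 7 * (7 : ℝ)⁻¹ ^ 6 + 2 * (7 : ℝ)⁻¹ ^ 7) = 8892 / 7 ^ 7 := by norm_num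
  rw [e1, e2, div_pow, div_lt_iff₀ hS]
  have hpow : (0 : ℝ) < (7 * sd - sn) ^ 7 := pow_pos hden 7
  have key : -((7 * (sd : ℝ)) ^ 7 / (7 * sd - sn) ^ 7 * (8892 / 7 ^ 7)) * SC = -(8892 * (sd : ℝ) ^ 7 * SC) / (7 * sd - sn) ^ 7 := by
    rw [eq_div_iff hpow.ne']
    field_simp
  rw [key, lt_div_iff₀ hpow]
  exact hGr

/-! ## §4. ★★★ The leaf `forceOutDir` and its soundness into the `hver` prune disjunct -/

/-- The direction is at most a unit vector: `Σ enₐ² ≤ ed²`. -/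
def dirOK (en : Fin 3 → ℤ) (ed : ℕ) : Bool := decide (0 < ed) && decide (en 0 ^ 2 + en 1 ^ 2 + en 2 ^ 2 ≤ (ed : ℤ) ^ 2)

/-- `dirOK` gives `0 < ed` and `‖dirVec en ed‖ ≤ 1`. [formal bookkeeping] -/
theorem norm_dirVec_le_one {en : Fin 3 → ℤ} {ed : ℕ} (h : dirOK en ed = true) : 0 < ed ∧ ‖dirVec en ed‖ ≤ 1 := by
  simp only [dirOK, Bool.and_eq_true, decide_eq_true_eq] at h
  obtain ⟨hed, hsq⟩ := h
  refine ⟨hed, ?_⟩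
  have hedr : (0 : ℝ) < ed := by exact_mod_cast hed
  have hsqr : ((en 0 : ℤ) : ℝ) ^ 2 + ((en 1 : ℤ) : ℝ) ^ 2 + ((en 2 : ℤ) : ℝ) ^ 2 ≤ (ed : ℝ) ^ 2 := by exact_mod_cast hsq
  have hn : ‖dirVec en ed‖ ^ 2 = (((en 0 : ℤ) : ℝ) ^ 2 + ((en 1 : ℤ) : ℝ) ^ 2 + ((en 2 : ℤ) : ℝ) ^ 2) / (ed : ℝ) ^ 2 := by
    rw [EuclideanSpace.norm_eq, Real.sq_sqrt (by positivity), Fin.sum_univ_three]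
    simp only [Real.norm_eq_abs, sq_abs, dirVec_apply]
    field_simp
  have h1 : ‖dirVec en ed‖ ^ 2 ≤ 1 := by rw [hn, div_le_one (by positivity)]; exact hsqr
  nlinarith [norm_nonneg (dirVec en ed)]

/-- ★★★ **`forceOutDir`** — the force/exempt prune leaf for ONE move direction `en/ed` and step `sn/sd` on an entry/shuffle box `(c, w)`
(twelve coordinates, `…HomEntryGramHcp` convention): direction at most unit, every label enclosed, and the box slope bound below the slack rate. -/
def forceOutDir (en : Fin 3 → ℤ) (ed : ℕ) (sn : ℤ) (sd : ℕ) (c w : (Fin 3 × Fin 3) ⊕ Fin 3 → ℤ) : Bool :=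
  dirOK en ed && decide (0 < sd) &&
    boxOK en ed sn sd (entryFI (fun ab => c (Sum.inl ab)) (fun ab => w (Sum.inl ab))) (shufFI c w) &&
    slopeTestOK (boxSlopeHi en ed sn sd (entryFI (fun ab => c (Sum.inl ab)) (fun ab => w (Sum.inl ab))) (shufFI c w)) sn sd

/-- ★★★ **SOUNDNESS OF `forceOutDir` INTO THE `hver` SHAPE**: `forceOutDir … c w = true` ⟹ for every `U` with `‖U − 1‖ ≤ 1/4` and entries in the box,
every `ξ` with `‖ξ‖ ≤ 1/4` in the shuffle box, and every injective enumeration of the homogeneous hcp `133/10`-ball with data `(U, ξ)`: the prune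
disjunct `Tight ∨ ExemptNear (9/5) ExRec z c ∨ Bad` (middle alternative), by hand-1 g26's `…HomExemptMoveBox.exemptNear_of_boxSlope`. [folklore] -/
theorem forceOutDir_sound {en : Fin 3 → ℤ} {ed : ℕ} {sn : ℤ} {sd : ℕ} {c w : (Fin 3 × Fin 3) ⊕ Fin 3 → ℤ}
    (h : forceOutDir en ed sn sd c w = true) (U : E3 →L[ℝ] E3) (ξ : E3) (hU : ‖U - 1‖ ≤ 1 / 4) (hξn : ‖ξ‖ ≤ 1 / 4)
    (hbox : ∀ ab : Fin 3 × Fin 3, |(U (EuclideanSpace.single ab.2 (1 : ℝ))) ab.1 - (c (Sum.inl ab) : ℝ) / SC| ≤ (w (Sum.inl ab) : ℝ) / SC)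
    (hξ : ∀ i : Fin 3, |ξ i - (c (Sum.inr i) : ℝ) / SC| ≤ (w (Sum.inr i) : ℝ) / SC) :
    ∀ (M : ℕ) (z : Fin M → E3) (cc : Fin M), Function.Injective z →
      Set.range z = {x : E3 | dist x (z cc) ≤ 133 / 10 ∧ ∃ a : Fin 3 → ℤ,
        x = z cc + latPt U hexFrame a ∨ x = z cc + latPt U hexFrame a + U (hcpShift + ξ)} →
      TightNearCap (9 / 5) (3 / 2) z cc ∨ ExemptNear (9 / 5) ExRec z cc ∨ BadNearCap (9 / 5) (3 / 2) z cc := by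
  intro M z cc hz hrange
  simp only [forceOutDir, Bool.and_eq_true, decide_eq_true_eq] at h
  obtain ⟨⟨⟨hdir, hsd⟩, hok⟩, htest⟩ := h
  obtain ⟨hed, he⟩ := norm_dirVec_le_one hdir
  obtain ⟨hs0, hs38, hG⟩ := lt_threshold_of_slopeTestOK hsd htest
  set G := boxSlopeHi en ed sn sd (entryFI (fun ab => c (Sum.inl ab)) (fun ab => w (Sum.inl ab))) (shufFI c w) with hGdef
  have hS := SC_pos
  refine Or.inr (Or.inl (exemptNear_of_boxSlope hz hU hξn hrange (dirVec en ed) he (s := (sn : ℝ) / sd) (b := -((G : ℝ) / SC)) hs0 hs38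
    (fun τ hτ => ?_) ?_))
  · -- the box sums are the `cutSlope` sums, bounded by `G/SC`
    have hle := boxSlope_le U ξ hU hξn hbox hξ hed hsd hok hτ.1 hτ.2
    have e : ∀ (v : E3), (if v ≠ 0 ∧ ‖v‖ ≤ 7 then
        ((‖τ • dirVec en ed - v‖⁻¹) ^ 8 - (‖τ • dirVec en ed - v‖⁻¹) ^ 14) * ⟪τ • dirVec en ed - v, dirVec en ed⟫ else 0) =
        cutSlope v (dirVec en ed) τ := fun v => rfl
    simp only [e]
    rw [neg_neg, le_div_iff₀ hS]
    exact hle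
  · -- the slack inequality from the threshold test
    have hs0' : (0 : ℝ) < (sn : ℝ) / sd := hs0
    nlinarith [hG, hs0']

end Summit.AtomisticToContinuum.Crystallization.Theorems.FrustratedLawDichotomyStrainedPatchHomForceSum
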